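import Literature.Analysis.FluidPDE.AlexakisDoeringRegularity
import Literature.Analysis.FluidPDE.NSUniqueness2DProofs
import HarnessLib

/-!
# Discharge of `AlexakisDoering2006_dissipation_sq_le` (Alexakis–Doering's `ε² ≤ ν U² χ`)

Trunk: FluidKinetic (`Literature/Analysis/FluidPDE`). The named fact
`Literature.Analysis.FluidPDE.AlexakisDoering2006_dissipation_sq_le` (`AlexakisDoering`;
Alexakis–Doering, *Energy and enstrophy dissipation in steady state 2d turbulence*, Phys. Lett.
A 359 (2006), §2, display "(trickI)" / arXiv:physics/0605090 eq. (21):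
`⟨ω²⟩² = ⟨u·∇×(k̂ω)⟩² ≤ ⟨|u|²⟩⟨|∇ω|²⟩`, i.e. `ε² ≤ ν U² χ`, for every global Leray–Hopf solution
of the 2-D Navier–Stokes equations on the unit torus driven by `F Φ(n • x)` with smooth datum and
`U > 0`) is now a theorem. `AlexakisDoeringRegularity` proved it relative to the two printed
inputs of two-dimensional regularity — strong existence with the enstrophy inequality
(Foias–Manley–Rosa–Temam 2001, Ch. II Thm. 7.4, `fmrt_strong_existence_torus2`, discharged in
`NSStrongSolutions2DProofs`) and uniqueness of Leray–Hopf weak solutions (op. cit. Thm. 7.3,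
Lions–Prodi 1959, `lions_prodi_uniqueness_torus2`) — and the latter has now been discharged
(`lions_prodi_uniqueness_torus2_holds`, `NSUniqueness2DProofs`). The whole chain — spectral
Cauchy–Schwarz in space and time with the `limsup` bookkeeping (`AlexakisDoeringInterpolation`),
measurability of the spectral slices (`LerayHopfSpectralMeasurability`), the Fourier–Galerkin
scheme on `𝕋²` with the enstrophy inequality and its Leray–Hopf limit
(`NSStrongSolutions2DProofs`), transfer along a.e.-equality (`NSStrongSolutions2D`), and the
Lions–Prodi uniqueness theorem (`NSUniqueness2DParts`, `NSUniqueness2DTruncatedBalance`,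
`NSUniqueness2DProofs`) — is proved in the tree; axioms `propext`, `Classical.choice`,
`Quot.sound` only. (A parallel route through the enstrophy *balance* is
`Literature.Barriers.AnomalousDissipation.AlexakisDoering2006_dissipation_sq_le_of_lionsProdi`.)

## References

* A. Alexakis, C. R. Doering, Phys. Lett. A 359 (2006), §2, display (trickI) / arXiv v1
  eq. (21). [AlexakisDoering2006PLA]
* C. Foias, O. Manley, R. Rosa, R. Temam, *Navier–Stokes Equations and Turbulence*, CUP 2001,
  Ch. II Thm. 7.3–7.4, App. II.A (A.65)–(A.67). [FoiasManleyRosaTemam2001]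
-/

noncomputable section

namespace Literature.Analysis.FluidPDE

/-- **Alexakis–Doering's interpolation step `ε² ≤ ν U² χ`, discharged** (Alexakis–Doering 2006,
§2, display "(trickI)" / arXiv eq. (21)): the named fact `AlexakisDoering2006_dissipation_sq_le`
holds — `AlexakisDoering2006_dissipation_sq_le_of_strong_of_uniqueness` fed with the discharged
strong-existence theorem `fmrt_strong_existence_torus2_holds` (FMRT Thm. 7.4) and the discharged
2-D uniqueness theorem `lions_prodi_uniqueness_torus2_holds` (FMRT Thm. 7.3). [cite: AlexakisDoering2006PLA, §2 display (trickI)] -/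
theorem AlexakisDoering2006_dissipation_sq_le_holds : AlexakisDoering2006_dissipation_sq_le :=
  AlexakisDoering2006_dissipation_sq_le_of_strong_of_uniqueness fmrt_strong_existence_torus2_holds
    lions_prodi_uniqueness_torus2_holds

end Literature.Analysis.FluidPDE

end
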